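import Literature.Probability.ImportanceSampling.EffectiveSampleSize
import HarnessLib

/-!
# Pooling equal-size member runs: the effective sample size `ESS^ = (Σ w)²/Σ w²` is subadditive
# (an elementary consequence of Elvira–Martino–Robert 2022 eq. (21) by Sedrakyan's lemma)

Topic `Probability/ImportanceSampling`; namespace `Literature.Probability.ImportanceSampling`;
companion of `EffectiveSampleSize.lean` (whose `essHat (w : Fin N → ℝ) = (Σ w)²/Σ w²` is EMR's
(21)). Theorems only (no definitions, no named facts, no new bibliography key).

Source of the DEFINITION, VERBATIM [cite: ElviraMartinoRobert2022, §3.1 eq. (21)] (V. Elvira,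
L. Martino, C. P. Robert, *Rethinking the effective sample size*, Int. Stat. Rev. 90 (2022) 525–550,
arXiv:1809.04129, held `paper:arxiv-1809.04129-gx87689900`): "the rule of thumb …
`ESS^ = N (1/N Σ_n w_n)² / (1/N Σ_n w_n²) = 1/Σ_{n=1}^N w̄_n²` (21)". The INEQUALITY typed here is
NOT printed there (nor in Martino–Elvira–Louzada 2017): it is the one-line consequence of (21) by
Sedrakyan's lemma (the Engel form of Cauchy–Schwarz, Mathlib `Finset.sq_sum_div_le_sum_sq_div`:
`(Σ_m a_m)²/Σ_m b_m ≤ Σ_m a_m²/b_m` for `b_m > 0`), and is labelled so at each statement.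

TYPED. `M` members of `N` weights each, `w m : Fin N → ℝ`, pooled into one vector on `Fin (M * N)`
through Mathlib's `finProdFinEquiv : Fin M × Fin N ≃ Fin (M * N)`; `S_m = Σ_n w m n`,
`Q_m = Σ_n (w m n)² ≠ 0`. **`essHat_pool_le_sum_essHat`**: `ESS^(pool) = (Σ_m S_m)²/Σ_m Q_m ≤
Σ_m S_m²/Q_m = Σ_m ESS^(w m)` (equality iff `S_m/Q_m` is the same for all members);
**`essHat_pool_div_le_avg`**: per draw, `ESS^(pool)/(M N) ≤ (1/M) Σ_m ESS^(w m)/N` — with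
ratio-of-sums pooling (`Σ|w|` and `Σw²` additive over members) the pooled `ESS/N` never exceeds the
member-mean `ESS/N`, the gap being the "mean of ratios versus ratio of means" term. v2 (same seat): **`sum_sq_div_sub_sq_sum_div_eq`** — Sedrakyan's DEFECT IDENTITY
`Σ a²/b − (Σa)²/Σb = Σ b (a/b − Σa/Σb)²` (`b > 0`); **`sum_essHat_sub_essHat_pool_eq`** — the pooling
gap `Σ_m ESS^(w m) − ESS^(pool)` IS the `Q`-weighted variance of the member ratios `S_m/Q_m` about
the pooled ratio; `essHat_pool_eq_sum_iff` (no loss iff all member ratios agree). Members of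
unequal sizes and random (self-normalised) weights are not treated. (Filed by the pub-qed literature
seat as a typed reading aid for the lane's pooled-versus-member ESS bookkeeping; VALUE-FREE, decides
no word, prices no cell. independent recomputation; certified where stated, statistical where
stated; no new-physics claim.)
-/

noncomputable section

open Finset

namespace Literature.Probability.ImportanceSampling

variable {N : ℕ}

section Pooling

variable {M : ℕ}

/-- Sums over the pooled index `Fin (M * N)` (member `m`, draw `n` ↦ `w m n`, through Mathlib's
`finProdFinEquiv : Fin M × Fin N ≃ Fin (M * N)`) are double sums. [folklore] -/
private theorem sum_pool (w : Fin M → Fin N → ℝ) :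
    ∑ p : Fin (M * N), w (finProdFinEquiv.symm p).1 (finProdFinEquiv.symm p).2 =
      ∑ m, ∑ n, w m n := by
  have h := Equiv.sum_comp finProdFinEquiv.symm (fun q : Fin M × Fin N => w q.1 q.2)
  rw [h, Fintype.sum_prod_type]

/-- The same for the squares. [folklore] -/
private theorem sum_pool_sq (w : Fin M → Fin N → ℝ) :
    ∑ p : Fin (M * N), w (finProdFinEquiv.symm p).1 (finProdFinEquiv.symm p).2 ^ 2 =
      ∑ m, ∑ n, w m n ^ 2 := by
  have h := Equiv.sum_comp finProdFinEquiv.symm (fun q : Fin M × Fin N => w q.1 q.2 ^ 2)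
  rw [h, Fintype.sum_prod_type]

/-- **Pooling `M` equal-size members never yields more than the SUM of their effective sample
sizes.** With member weights `w m : Fin N → ℝ` (each member having a nonzero weight) and the pooled
vector `u` on `Fin (M * N)` (`u(m, n) = w m n`): writing `S_m = Σ_n w m n`, `Q_m = Σ_n (w m n)²`,
`ESS^(u) = (Σ_m S_m)²/Σ_m Q_m ≤ Σ_m S_m²/Q_m = Σ_m ESS^(w m)` — Sedrakyan's lemma (Engel form of
Cauchy–Schwarz; Mathlib `Finset.sq_sum_div_le_sum_sq_div`), with equality iff `S_m/Q_m` does not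
depend on `m`. Not printed in the sources: an elementary consequence of definition (21), typed
because the lane pools equal-size member runs and compares "ratio of means" with "mean of ratios".
[cite: ElviraMartinoRobert2022, §3.1 eq. (21) (definition of ESS^; the inequality is a one-line consequence, not printed)] -/
theorem essHat_pool_le_sum_essHat (w : Fin M → Fin N → ℝ) (hQ : ∀ m, ∑ n, w m n ^ 2 ≠ 0) :
    essHat (fun p : Fin (M * N) ↦ w (finProdFinEquiv.symm p).1 (finProdFinEquiv.symm p).2) ≤
      ∑ m, essHat (w m) := by
  show (∑ p : Fin (M * N), w (finProdFinEquiv.symm p).1 (finProdFinEquiv.symm p).2) ^ 2 /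
      ∑ p : Fin (M * N), w (finProdFinEquiv.symm p).1 (finProdFinEquiv.symm p).2 ^ 2 ≤
      ∑ m, (∑ n, w m n) ^ 2 / ∑ n, w m n ^ 2
  rw [sum_pool, sum_pool_sq]
  have hQ' : ∀ m ∈ (Finset.univ : Finset (Fin M)), 0 < ∑ n, w m n ^ 2 := fun m _ ↦
    lt_of_le_of_ne (Finset.sum_nonneg fun n _ ↦ sq_nonneg (w m n)) (Ne.symm (hQ m))
  exact Finset.sq_sum_div_le_sum_sq_div Finset.univ (fun m ↦ ∑ n, w m n) hQ'

/-- **Per draw: the pooled `ESS^/N` is at most the member-MEAN of `ESS^/N`** (equal-size members):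
`ESS^(u)/(M N) ≤ (1/M) Σ_m ESS^(w m)/N`. Same elementary consequence.
[cite: ElviraMartinoRobert2022, §3.1 eq. (21) (definition; consequence not printed)] -/
theorem essHat_pool_div_le_avg (w : Fin M → Fin N → ℝ) (hQ : ∀ m, ∑ n, w m n ^ 2 ≠ 0) :
    essHat (fun p : Fin (M * N) ↦ w (finProdFinEquiv.symm p).1 (finProdFinEquiv.symm p).2) /
        ((M : ℝ) * N) ≤ (∑ m, essHat (w m) / N) / M := by
  have h := essHat_pool_le_sum_essHat w hQ
  have hr : (∑ m, essHat (w m) / N) / M = (∑ m, essHat (w m)) / ((M : ℝ) * N) := by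
    rw [← Finset.sum_div, div_div, mul_comm]
  rw [hr]
  exact div_le_div_of_nonneg_right h (by positivity)


/-! ### v2 — Sedrakyan's DEFECT IDENTITY: the gap is a weighted variance of the member ratios -/

/-- **Sedrakyan's defect identity** (finite weighted form): for `b_i > 0`,
`Σ_i a_i²/b_i − (Σ_i a_i)²/(Σ_i b_i) = Σ_i b_i (a_i/b_i − (Σ a)/(Σ b))²` — the slack in the Engel
form of Cauchy–Schwarz is the `b`-weighted variance of the ratios `a_i/b_i` about the pooled ratio.
Elementary algebra (not printed in the sources); it yields `Finset.sq_sum_div_le_sum_sq_div` with its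
equality case. [cite: ElviraMartinoRobert2022, §3.1 eq. (21) (context only; identity not printed)] -/
theorem sum_sq_div_sub_sq_sum_div_eq {ι : Type*} (s : Finset ι) (a : ι → ℝ) {b : ι → ℝ}
    (hb : ∀ i ∈ s, 0 < b i) :
    ∑ i ∈ s, a i ^ 2 / b i - (∑ i ∈ s, a i) ^ 2 / ∑ i ∈ s, b i =
      ∑ i ∈ s, b i * (a i / b i - (∑ j ∈ s, a j) / ∑ j ∈ s, b j) ^ 2 := by
  set r : ℝ := (∑ j ∈ s, a j) / ∑ j ∈ s, b j with hr
  -- expand the square termwise: b (a/b - r)² = a²/b - 2 r a + r² b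
  have hexp : ∑ i ∈ s, b i * (a i / b i - r) ^ 2 =
      ∑ i ∈ s, (a i ^ 2 / b i - 2 * r * a i + r ^ 2 * b i) := by
    refine Finset.sum_congr rfl fun i hi => ?_
    have hbi : b i ≠ 0 := (hb i hi).ne'
    field_simp
    ring
  rw [hexp, Finset.sum_add_distrib, Finset.sum_sub_distrib, ← Finset.mul_sum, ← Finset.mul_sum]
  -- case on whether the total `Σ b` vanishes (then `s = ∅`)
  by_cases hB : ∑ j ∈ s, b j = 0
  · have hs : s = ∅ := by
      by_contra hne
      obtain ⟨i, hi⟩ := Finset.nonempty_iff_ne_empty.mpr hne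
      have : 0 < ∑ j ∈ s, b j := Finset.sum_pos hb ⟨i, hi⟩
      linarith
    simp [hs]
  · have hrr : r * ∑ j ∈ s, b j = ∑ j ∈ s, a j := by rw [hr, div_mul_cancel₀ _ hB]
    have h1 : r ^ 2 * ∑ i ∈ s, b i = r * ∑ j ∈ s, a j := by rw [sq, mul_assoc, hrr]
    have h2 : (∑ i ∈ s, a i) ^ 2 / ∑ i ∈ s, b i = r * ∑ j ∈ s, a j := by
      rw [hr, sq, div_mul_eq_mul_div]
    rw [h1, h2]
    ring

/-- **The pooling gap of `ESS^` is the `Q`-weighted variance of the member ratios**: with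
`S_m = Σ_n w m n`, `Q_m = Σ_n (w m n)² ≠ 0`,
`Σ_m ESS^(w m) − ESS^(pool) = Σ_m Q_m (S_m/Q_m − (Σ S)/(Σ Q))²` — so the pooled effective sample
size falls short of the members' sum by exactly the dispersion of the ratios `S_m/Q_m` (equal ratios
⇔ no loss). Elementary consequence (Sedrakyan's defect identity) of definition (21).
[cite: ElviraMartinoRobert2022, §3.1 eq. (21) (definition; identity not printed)] -/
theorem sum_essHat_sub_essHat_pool_eq (w : Fin M → Fin N → ℝ) (hQ : ∀ m, ∑ n, w m n ^ 2 ≠ 0) :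
    (∑ m, essHat (w m)) -
        essHat (fun p : Fin (M * N) ↦ w (finProdFinEquiv.symm p).1 (finProdFinEquiv.symm p).2) =
      ∑ m, (∑ n, w m n ^ 2) *
        ((∑ n, w m n) / (∑ n, w m n ^ 2) - (∑ m, ∑ n, w m n) / ∑ m, ∑ n, w m n ^ 2) ^ 2 := by
  show (∑ m, (∑ n, w m n) ^ 2 / ∑ n, w m n ^ 2) -
      (∑ p : Fin (M * N), w (finProdFinEquiv.symm p).1 (finProdFinEquiv.symm p).2) ^ 2 /
        ∑ p : Fin (M * N), w (finProdFinEquiv.symm p).1 (finProdFinEquiv.symm p).2 ^ 2 = _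
  rw [sum_pool, sum_pool_sq]
  have hQ' : ∀ m ∈ (Finset.univ : Finset (Fin M)), 0 < ∑ n, w m n ^ 2 := fun m _ ↦
    lt_of_le_of_ne (Finset.sum_nonneg fun n _ ↦ sq_nonneg (w m n)) (Ne.symm (hQ m))
  exact sum_sq_div_sub_sq_sum_div_eq Finset.univ (fun m ↦ ∑ n, w m n) hQ'

/-- **Equality case**: the pooled `ESS^` equals the sum of the member `ESS^`s iff every member has
the same ratio `S_m/Q_m` as the pool. [cite: ElviraMartinoRobert2022, §3.1 eq. (21) (definition; consequence not printed)] -/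
theorem essHat_pool_eq_sum_iff (w : Fin M → Fin N → ℝ) (hQ : ∀ m, ∑ n, w m n ^ 2 ≠ 0) :
    essHat (fun p : Fin (M * N) ↦ w (finProdFinEquiv.symm p).1 (finProdFinEquiv.symm p).2) =
        ∑ m, essHat (w m) ↔
      ∀ m, (∑ n, w m n) / (∑ n, w m n ^ 2) = (∑ m, ∑ n, w m n) / ∑ m, ∑ n, w m n ^ 2 := by
  have hgap := sum_essHat_sub_essHat_pool_eq w hQ
  have hQpos : ∀ m, 0 < ∑ n, w m n ^ 2 := fun m ↦
    lt_of_le_of_ne (Finset.sum_nonneg fun n _ ↦ sq_nonneg (w m n)) (Ne.symm (hQ m))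
  constructor
  · intro heq m
    have hzero : ∑ m, (∑ n, w m n ^ 2) *
        ((∑ n, w m n) / (∑ n, w m n ^ 2) - (∑ m, ∑ n, w m n) / ∑ m, ∑ n, w m n ^ 2) ^ 2 = 0 := by
      rw [← hgap, heq, sub_self]
    have hterm := (Finset.sum_eq_zero_iff_of_nonneg fun m _ ↦
      mul_nonneg (hQpos m).le (sq_nonneg _)).mp hzero m (Finset.mem_univ m)
    rcases mul_eq_zero.mp hterm with h | h
    · exact absurd h (hQpos m).ne'
    · exact sub_eq_zero.mp (pow_eq_zero_iff two_ne_zero |>.mp h)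
  · intro hall
    have hzero : ∑ m, (∑ n, w m n ^ 2) *
        ((∑ n, w m n) / (∑ n, w m n ^ 2) - (∑ m, ∑ n, w m n) / ∑ m, ∑ n, w m n ^ 2) ^ 2 = 0 :=
      Finset.sum_eq_zero fun m _ ↦ by rw [hall m, sub_self, zero_pow two_ne_zero, mul_zero]
    rw [hzero] at hgap
    linarith

end Pooling

end Literature.Probability.ImportanceSampling
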